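import Mathlib.Topology.MetricSpace.HausdorffDimension
import Literature.Analysis.FluidPDE.LerayHopf
import HarnessLib

/-!
# Barrier: sharp non-uniqueness of weak solutions in `L^p_t L^∞_x`, `p < 2` (Cheskidov–Luo 2022)

Barrier catalogue entry for `NavierStokesRegularity` (D-0021). Vendors, as named facts over the
accepted torus vocabulary (`Literature.Analysis.FunctionSpaces.Torus.IsWeakNSSolutionWithDataOn`, `Literature.Analysis.FluidPDE.Torus.MemLqLp`,
`Literature.Analysis.FunctionSpaces.Torus.IsSmoothSpaceTimeOn`, `Literature.Analysis.FunctionSpaces.Torus.IsClassicalNSSolutionOn`, `Literature.Analysis.FluidPDE.Torus.IsLerayHopfOn`,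
`Literature.Analysis.FunctionSpaces.Torus.HasZeroMean`), Theorems 1.6 and 1.7 of A. Cheskidov, X. Luo, *Sharp nonuniqueness for
the Navier–Stokes equations*, Invent. Math. 229 (2022), 987–1054 (arXiv:2009.06596): in every
dimension `d ≥ 2` and for every `1 ≤ p < 2`, weak solutions of the unforced Navier–Stokes equations
on `𝕋^d` are NOT unique in the class `L^p(0,T; L^∞(𝕋^d))` — whereas in every class
`X^{p,q} = L^p(0,T; L^q)` with `2/p + d/q ≤ 1` they are unique and Leray–Hopf (their Thm. 1.3,
Fabes–Jones–Rivière, Kato, Lions–Masmoudi, …). The non-uniqueness side is the barrier.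

## What is printed (numbering of the held copy arXiv:2009.06596)

* §1.1, setting: `𝕋^d = ℝ^d/ℤ^d`, `d ≥ 2`, the equations `∂ₜu - Δu + div(u ⊗ u) + ∇p = 0`,
  `div u = 0` (viscosity `1`, no force) on `[0,T]`, "solutions with zero spacial mean". Def. 1.1
  (weak solution with datum `u₀ ∈ L²` weakly divergence free): `u ∈ L²([0,T] × 𝕋^d)`, weakly
  divergence free for a.e. `t`, and
  `∫ u₀·φ(0) = -∫₀ᵀ∫ u·(∂ₜφ + Δφ + u·∇φ)` for all divergence-free `φ ∈ C^∞(ℝ × 𝕋^d)` with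
  `φ = 0` for `t ≥ T`. Def. 1.2: Leray–Hopf = `C_w L² ∩ L² H¹` with the energy inequality.
* Thm. 1.3 (Fabes–Jones–Rivière, Kato, Furioli–Lemarié-Rieusset–Terraneo, Lions–Masmoudi; a proof
  is included in their appendix on `X^{p,q}` weak solutions): a weak solution in
  `X^{p,q}([0,T]; 𝕋^d)` with `2/p + d/q ≤ 1` is unique in `X^{p,q}` and is Leray–Hopf.
  Conjecture 1.4: for `2/p + d/q > 1` there are two weak solutions in `X^{p,q}` with the same datum,
  and a non-Leray–Hopf one.
* Thm. 1.6 (Sharp nonuniqueness in `d ≥ 2`): "Let `d ≥ 2` be the dimension and `1 ≤ p < 2`.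
  1. A weak solution `u ∈ L^p(0,T; L^∞(𝕋^d))` of (1.1) is not unique in the class
  `L^p(0,T; L^∞(𝕋^d))` if `u` has at least one interval of regularity [footnote: In particular,
  it can be applied to a smooth solution to obtain a nonunique weak solution in the class
  `L^p_t L^∞`]. 2. There exist non-Leray–Hopf weak solutions `u ∈ L^p(0,T; L^∞(𝕋^d))`."
  Proof (§2.6): given an interval of regularity `[a,b]` of `v`, a non-Leray–Hopf weak solution
  `u ∈ L^p L^∞` with the same datum and `‖u - v‖_{L^p L^∞} ≥ 1 - ε` is glued from Thm. 1.7.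
  "In view of Theorem 1.3, nonunique solutions cannot live in the class `L²_t L^∞`"; "the below
  theorem settles Conjecture 1.4 in the case `q = ∞`".
* Thm. 1.7 (main theorem): for `d ≥ 2`, `1 ≤ p < 2`, `q < ∞`, `ε > 0` and any smooth
  divergence-free `v ∈ C^∞([0,T] × 𝕋^d)` with zero spatial mean for each `t`, there exist a weak
  solution `u` of (1.1) and `𝓘 = ⋃ᵢ (aᵢ,bᵢ) ⊂ [0,T]` with: `u ∈ L^p(0,T;L^∞) ∩ L¹(0,T;W^{1,q})`;
  `u|_{𝓘 × 𝕋^d} ∈ C^∞`; "`u` agrees with the smooth solution emerging from the initial data `v(0)`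
  near `t = 0`"; `dim_H([0,T] ∖ 𝓘) ≤ ε`; `‖u - v‖_{L^p L^∞ ∩ L¹ W^{1,q}} ≤ ε`.
* §1.6: "the method … heavily relies on the constraint `p < 2` (`q = ∞`) and is not able to achieve
  the nonuniqueness of weak solutions in `X^{p,q}` for `p ≥ 2` and `q ≥ 2`"; the solutions "are
  not Leray–Hopf"; Thm. 1.5: in `d = 2` EVERY weak solution is non-unique.
* §1.1 p. 3: "Even though the solutions constructed in this paper live on a borderline of a class
  of Leray-Hopf solutions, they do not have the regularity to justify (the energy inequality) and
  are not Leray-Hopf solutions; whether Leray-Hopf solutions are unique in dimension `d ≥ 3`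
  remains a challenging open question." §1.2 p. 5 (after Thm. 1.6): Thm. 1.6 "raises the question
  of whether such constructions can be extended to the Leray-Hopf solutions"; "for any smooth
  initial data, there are infinitely many weak solutions with regularity `L^p_t L^∞` emerging from
  the same data". Rem. 1.8 (p. 5): on each `(aᵢ,bᵢ)` the energy EQUALITY holds; "There is no blowup
  on each intervals of regularity `(aᵢ,bᵢ)` but norms do blow up as `i → ∞`"; §1.4 p. 5 (Euler
  version, same construction): "the kinetic energy of our solutions becomes unbounded in a
  piece-wise constant fashion". §2.6 p. 12 (proof of Thm. 1.6): the competitor `u` is separated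
  from the Leray–Hopf class by `‖u‖_{L^p_t L²} > ‖v(0)‖₂`, "and Leray-Hopf solutions must have
  non-increasing `L²` norm".
* §1.2 p. 4 (state of Conjecture 1.4 before this paper): non-uniqueness of weak solutions was known
  in `C_t L^{2+}` (Buckmaster–Vicol 2019; Buckmaster–Colombo–Vicol 2021) in `d = 3` and in
  `H^{1/200-}` (Luo 2019) in `d ≥ 4`; §1.6 p. 6: "we expect the nonuniqueness of weak solutions
  continue to hold in the full range of the super-critical regime `2/p + d/q > 1`".

## Rendering

`𝕋^d` is `UnitAddTorus (Fin n)`, `n ≥ 2`; viscosity `1`, no force, as printed. CL's Def. 1.1 is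
rendered by the accepted `Torus.IsWeakNSSolutionWithDataOn T 1 u₀ u` (same pressure-free identity
with the datum term; the accepted predicate tests against smooth divergence-free fields vanishing
NEAR `T`, CL against those vanishing for `t ≥ T` — for `L²_{t,x}` fields the two identities are
equivalent by a cut-off in time, and in the `∀∃` statement below the difference only weakens the
hypothesis side), plus the printed standing condition of zero spatial mean for a.e. `t`.
`u ∈ L^p(0,T; L^∞)` is `Torus.MemLqLp (ENNReal.ofReal p) ∞ u (Ioo 0 T)`; an "interval of
regularity" is a non-trivial `[a,b] ⊆ [0,T]` with `u` jointly smooth on `[a,b] × 𝕋^d`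
(`Torus.IsSmoothSpaceTimeOn (Icc a b)`; CL's proof of Thm. 1.6 works with such a closed
interval); "different weak solution" is `¬ (v(t) = u(t) a.e., for a.e. t)`; "non-Leray–Hopf" is the
negation of the accepted (stronger) `Torus.IsLerayHopfOn T 1 0 u₀`. In Thm. 1.7 the `L¹_t W^{1,q}`
half of the regularity and of the `ε`-closeness is NOT rendered (no `W^{1,q}(𝕋^d)` vocabulary in
the tree); `dim_H` is Mathlib's `dimH`.

## Audit 2026-08-16 (barrier-audit, D-0021)

* FORMAL STATUS. The fact below is PROVED in the tree: `SharpLpLinftyNonuniqueness_holds`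
  (`SharpLpLinftyNonuniquenessProofs.lean`: Thm. 1.6 ⇐ Thm. 1.7 by the printed gluing of §2.6)
  and `CheskidovLuo2022MainTheorem_holds` (`SharpLpLinftyNonuniquenessMainTheoremHolds.lean`:
  Thm. 1.7 ⇐ Prop. 2.2 ⇐ Props. 3.1, 4.1, all proved), axioms `propext`, `Classical.choice`,
  `Quot.sound` only. The rendering was re-read against print (Def. 1.1 p. 3 = accepted
  `Torus.IsWeakNSSolutionWithDataOn` up to the test class of scope (iii); Thm. 1.6 p. 5; proof
  §2.6 pp. 11–12 with a closed interval of regularity `[a,b]`, which print never defines formally —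
  §1.3 p. 5: "classical solutions on many sub-intervals"): faithful; no junk instance (the weak
  formulation carries `u ∈ L²_{t,x}`, the mixed norm is the guarded `Torus.MemLqLp`, and
  "not Leray–Hopf" is derived, as in print, from the energy inequality from `t = 0`).
* TECHNIQUE CLASS ACTUALLY COVERED. Thm. 1.6 is a STRONG non-uniqueness statement about very
  weak solutions (Def. 1.1): a uniqueness / selection criterion "weak solutions in a class `Y` are
  determined by their datum" is refuted by this entry exactly when `Y` contains the competitors,
  i.e. for `Y ⊇ {zero-mean very weak solutions in L^p_t L^∞_x ∩ L¹_t W^{1,q}_x, smooth off a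
  closed set of times of dimension ≤ ε}`, `1 ≤ p < 2`, `q < ∞`. The competitors have UNBOUNDED
  kinetic energy and violate the energy inequality (print above), so criteria whose class carries
  an energy ceiling (`L^∞_t L²_x`, `C_t L²_x`), the energy class `L^∞_t L² ∩ L²_t H¹`, the
  energy inequality (Leray–Hopf, suitable) or forward-in-time hypotheses on classical solutions
  are NOT covered — see `evasions_known` (b) of the block. The same supercritical class is reached
  technique-independently by the instantaneous Type-I blow-up of Cheskidov–Dai–Palasek
  (competitors in `L^{2,∞}_t L^∞_x`, `C^∞(𝕋^d)` at every time, from every smooth datum;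
  catalogued `InstantaneousTypeIBlowup`), whose Thm. 1.11 is the printed energy-class evasion.
* LITERATURE SINCE 2022 (searched 2026-08-16: forward citations of arXiv:2009.06596, arXiv
  full text; OpenAlex/searchd degraded that day). Reinforcing, none contradicting:
  Cheskidov–Dai–Palasek 2025 (arXiv:2511.09556, Thms. 1.1, 1.10, 1.11); Hou–Wang–Yang 2025
  (arXiv:2509.25116, Thm. 1, computer-assisted, unrefereed: infinitely many suitable Leray–Hopf
  solutions on `ℝ³ × [0,1]` from one rough compactly supported `L²` datum, in every
  `L^s_t L^q_x`, `q ≥ 2`, `3/q + 2/s > 1`); Miao–Nie–Ye 2024 (arXiv:2412.10404, Thm. 1.2: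
  `C_t L²(ℝ³)` non-uniqueness with prescribed energies — the whole-space Buckmaster–Vicol);
  Cheskidov–Zeng–Zhang 2024 (arXiv:2407.17463, Thm. 1.1: for EVERY `L²` datum infinitely many
  `C([0,∞);L²(𝕋³))` solutions); Miao–Zhao 2025 (arXiv:2501.09698, Thm. 1.2: `C_t L^q(𝕋³)` for
  some `2 < q ≪ 3`); Fujii 2026 (arXiv:2602.19846: non-uniqueness of MILD solutions on `ℝⁿ` in the
  critical Besov classes `C_t Ḃ^{n/p-1}_{p,q}`, `p > n` or `p = n, q > 2`; different solution
  notion). Open as of the audit: the supercritical mixed classes with `2 ≤ p < ∞` near the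
  Ladyzhenskaya–Prodi–Serrin line and `C_t L^q_x` with `q ↑ d`; uniqueness of weak solutions on
  `𝕋^d` in `L^∞_t L²_x ∩ L^p_t L^∞_x` or in the Leray–Hopf class `∩ L^p_t L^∞_x`, `p < 2`, from
  regular data; Type-I exclusion.

## References

* A. Cheskidov, X. Luo, Invent. Math. 229 (2022), 987–1054; arXiv:2009.06596. [`CheskidovLuo2022`]
* in-tree: `Literature.Analysis.FluidPDE.weak_strong_uniqueness`, `Literature.Analysis.FluidPDE.ladyzhenskaya_prodi_serrin`
  (`Literature/Analysis/FluidPDE/NSLerayHopf.lean`, ns.S07).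
* A. Cheskidov, M. Dai, S. Palasek, arXiv:2511.09556 (2025), Thms. 1.1, 1.10, 1.11. [`CheskidovDaiPalasek2025`]
* T. Y. Hou, Y. Wang, C. Yang, arXiv:2509.25116 (2025), Thm. 1 (computer-assisted). [`HouWangYang2025`]
* T. Buckmaster, V. Vicol, Ann. of Math. 189 (2019), Thm. 1.2 [`BuckmasterVicol2019AnnMath`];
  T. Buckmaster, M. Colombo, V. Vicol, JEMS 24 (2021), Thm. 1.1 [`BuckmasterColomboVicol2021`];
  A. Cheskidov, Z. Zeng, D. Zhang, arXiv:2407.17463, Thm. 1.1 [`CheskidovZengZhang2024`];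
  C. Miao, Y. Nie, W. Ye, arXiv:2412.10404 (2024), Thm. 1.2; C. Miao, Z. Zhao, arXiv:2501.09698
  (2025), Thm. 1.2; X. Luo, Arch. Ration. Mech. Anal. 233 (2019) (stationary solutions, `d ≥ 4`);
  M. Fujii, arXiv:2602.19846 (2026) [`Fujii2026`].
-/

noncomputable section

open MeasureTheory Set Filter Topology
open scoped ENNReal

namespace Literature.Barriers.NavierStokesRegularity

/-- Local notation: the flat `n`-torus `𝕋ⁿ = (ℝ/ℤ)ⁿ`. -/
local notation "𝕋^" n => UnitAddTorus (Fin n)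
/-- Local notation: the value space `ℝⁿ`. -/
local notation "ℝ^" n => EuclideanSpace ℝ (Fin n)

/-- **Cheskidov–Luo 2022, Thm. 1.7 (main theorem), rendered without the `W^{1,q}` clauses.**
For `n ≥ 2`, `T > 0`, `1 ≤ p < 2`, `ε > 0` and every space–time field `v` jointly smooth on
`[0,T] × 𝕋ⁿ`, divergence free and of zero spatial mean at each `t ∈ [0,T]`, there is a weak
solution `u` of the unforced Navier–Stokes equations (viscosity `1`) on `𝕋ⁿ × [0,T)` with datum
`v(0)` (accepted `Torus.IsWeakNSSolutionWithDataOn`), of zero mean for a.e. `t`, with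
`u ∈ L^p(0,T; L^∞)`, which coincides on some `[0,τ]`, `τ > 0`, with a classical solution issued
from `v(0)` ("`u` agrees with the smooth solution emerging from the initial data `v(0)` near
`t = 0`"), which is jointly smooth on `𝓘 × 𝕋ⁿ` for an open `𝓘 ⊆ [0,T]` whose complement in `[0,T]`
has Hausdorff dimension `≤ ε`, and with `‖u - v‖_{L^p(0,T;L^∞)} ≤ ε`. Print has moreover
`u ∈ L¹(0,T; W^{1,q})` for any given `q < ∞` and `ε`-closeness also in that norm (not rendered).
[cite: CheskidovLuo2022, Thm. 1.7] -/
def CheskidovLuo2022MainTheorem : Prop :=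
  ∀ (n : ℕ), 2 ≤ n → ∀ (T : ℝ), 0 < T → ∀ (p : ℝ), 1 ≤ p → p < 2 → ∀ (ε : ℝ), 0 < ε →
    ∀ v : ℝ → (𝕋^n) → ℝ^n, Literature.Analysis.FunctionSpaces.Torus.IsSmoothSpaceTimeOn (Icc 0 T) v →
      (∀ t ∈ Icc 0 T, Literature.Analysis.FunctionSpaces.Torus.IsDivFree (v t)) → (∀ t ∈ Icc 0 T, Literature.Analysis.FunctionSpaces.Torus.HasZeroMean (v t)) →
      ∃ u : ℝ → (𝕋^n) → ℝ^n,
        Literature.Analysis.FunctionSpaces.Torus.IsWeakNSSolutionWithDataOn T 1 (v 0) u ∧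
        (∀ᵐ t ∂(volume.restrict (Ioo 0 T)), Literature.Analysis.FunctionSpaces.Torus.HasZeroMean (u t)) ∧
        Literature.Analysis.FluidPDE.Torus.MemLqLp (ENNReal.ofReal p) ∞ u (Ioo 0 T) ∧
        (∃ τ : ℝ, 0 < τ ∧ τ ≤ T ∧ ∃ (w : ℝ → (𝕋^n) → ℝ^n) (π : ℝ → (𝕋^n) → ℝ),
          Literature.Analysis.FunctionSpaces.Torus.IsClassicalNSSolutionOn (Icc 0 τ) 1 0 w π ∧ w 0 = v 0 ∧ ∀ t ∈ Icc 0 τ, u t = w t) ∧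
        (∃ I : Set ℝ, IsOpen I ∧ I ⊆ Icc 0 T ∧ Literature.Analysis.FunctionSpaces.Torus.IsSmoothSpaceTimeOn I u ∧
          dimH (Icc 0 T \ I) ≤ ENNReal.ofReal ε) ∧
        Literature.Analysis.FluidPDE.Torus.eLqLpNorm (ENNReal.ofReal p) ∞ (u - v) (Ioo 0 T) ≤ ENNReal.ofReal ε

/-- **Barrier (Cheskidov–Luo 2022, Thm. 1.6): sharp (strong) non-uniqueness of weak solutions in
`L^p_t L^∞_x`, `p < 2`, in every dimension `d ≥ 2`.** For `n ≥ 2`, `T > 0`, `1 ≤ p < 2`: every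
weak solution `u` of the unforced Navier–Stokes equations (viscosity `1`) on `𝕋ⁿ × [0,T)` with an
`L²`, weakly divergence-free, zero-mean datum `u₀` (accepted `Torus.IsWeakNSSolutionWithDataOn`),
of zero spatial mean for a.e. `t`, lying in `L^p(0,T; L^∞(𝕋ⁿ))` and possessing at least one
interval of regularity `[a,b] ⊆ [0,T]` (`u` jointly smooth on `[a,b] × 𝕋ⁿ`), admits a SECOND weak
solution `v` with the same datum, again of zero mean and in `L^p(0,T; L^∞)`, which is not a.e.
equal to `u` and which is not Leray–Hopf. By their Thm. 1.3 this fails for `p = 2`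
(`2/p + d/q ≤ 1` gives uniqueness), whence "sharp".
[cite: CheskidovLuo2022, Thm. 1.6 and its proof in §2.6]

BARRIER (structured block, D-0021):
technique_class: supercritical-integrability-class-uniqueness weak-solution-uniqueness-criteria mixed-lebesgue-class-selection sub-LPS-uniqueness very-weak-solution-wellposedness weak-solution-uniqueness
blocks: any extension of the uniqueness classes `X^{p,q} = L^p_t L^q_x`, `2/p + d/q ≤ 1` — very weak solutions there are unique and Leray–Hopf [cite: CheskidovLuo2022, Thm. 1.3] — to the supercritical class `L^p_t L^∞_x`, `1 ≤ p < 2`, as a uniqueness or selection criterion for VERY WEAK solutions (Def. 1.1: `L²_{t,x}`, no energy information) on `𝕋^d`, `d ≥ 2`, also in combination with zero mean, `L¹_t W^{1,q}_x` (`q < ∞`) and smoothness off a closed set of times of Hausdorff dimension `≤ ε`: "nonunique solutions cannot live in the class `L²_t L^∞`. However, Theorem 1.6 shows the existence of nonunique solutions on the borderline of this Leray–Hopf class"; it "settles Conjecture 1.4 in the case `q = ∞`"; every such solution with one interval of regularity — in particular every classical solution — has infinitely many competitors in the class [cite: CheskidovLuo2022, Thm. 1.6, Thm. 1.7 and §1.2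 p. 5]; hence no well-posedness statement for the periodic problem (`Literature.Analysis.FluidPDE.NavierStokesExistenceSmoothPeriodic` concerns smooth solutions) can select weak solutions by membership in `L^p_t L^∞_x`, `p < 2`, even with the listed side conditions [cite: CheskidovLuo2022, Thm. 1.7]. The same class is reached by a second, technique-independent mechanism: instantaneous Type-I blow-up from ARBITRARY smooth data gives competitors in `L^{2,∞}_t L^∞_x ⊂ L^p_t L^∞_x` which are `C^∞(𝕋^d)` at every time [cite: CheskidovDaiPalasek2025, Thm. 1.1] (catalogued `InstantaneousTypeIBlowup`). The nearest accepted in-tree uniqueness facts, `Literature.Analysis.FluidPDE.weak_strong_uniqueness` / `Literature.Analysis.FluidPDE.ladyzhenskaya_prodi_serrin` (ns.S07, Leray–Hopf solutions on `ℝ³`), are NOT extended-and-refuted by this entry: their Leray–Hopf hypothesis is outside its scope (evasion (b), scope (ii), (vi)).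
because: a two-step iteration on the Navier–Stokes–Reynolds system: (1) the stress error is concentrated on many short sub-intervals by exact short-time solves plus sharp cut-offs, which makes the limit smooth on the complement of a set of times of dimension `≤ ε`; (2) a space–time convex-integration step with temporally intermittent Mikado flows trades time integrability for spatial regularity — the scheme is `L²_{t,x}`-critical, and `L^p_t` with `p < 2` in time buys `L^∞_x` (and `L¹_t` buys `W^{1,q}_x`) [cite: CheskidovLuo2022, §1.5, §2.2–2.4 and Prop. 2.2].
evasions_known: (a) impose a critical or subcritical class: in `X^{p,q}` with `2/p + d/q ≤ 1` (e.g. `L²_t L^∞_x`, `C_t L^d_x`) very weak solutions are unique and Leray–Hopf [cite: CheskidovLuo2022, Thm. 1.3]; a weak solution with a classical datum lying in `L²_t L^∞_x` IS the classical solution [cite: CheskidovDaiPalasek2025, Thm. 1.10]; (b) impose energy information: the competitors of Thms. 1.6/1.7 "do not have the regularity to justify (the energy inequality) and are not Leray-Hopf solutions" [cite: CheskidovLuo2022, §1.1 p. 3], their kinetic energy is unbounded ("norms do blow up as `i → ∞`"; "the kinetic energy of our solutions becomes unbounded") [cite: CheskidovLuo2022, Rem. 1.8 and §1.4 p. 5],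 and the proof of Thm. 1.6 separates the competitor from the Leray–Hopf class exactly by `‖·‖_{L^p_t L²_x} > ‖u(0)‖₂` [cite: CheskidovLuo2022, §2.6 p. 12]; for the zero datum `u ∈ L^∞_t L² ∩ L²_t Ḣ¹ ∩ L^{2,∞}_t L^∞_x` (or `u ∈ L²_t Ḣ¹ ∩ L^∞_t B^{-1}_{∞,∞}`) forces `u ≡ 0` [cite: CheskidovDaiPalasek2025, Thm. 1.11] — so no catalogued construction decides uniqueness of weak solutions on `𝕋^d` in `L^∞_t L²_x ∩ L^p_t L^∞_x`, in the energy class `(L^∞_t L² ∩ L²_t H¹) ∩ L^p_t L^∞_x`, or in the Leray–Hopf class `∩ L^p_t L^∞_x`, `1 ≤ p < 2`: the finite-energy convex-integration solutions live in `C_t L²` / `C_t H^β` / `C_t L^{2+}` [cite: BuckmasterVicol2019AnnMath, Thm. 1.2] [cite: BuckmasterColomboVicol2021, Thm. 1.1] [cite: CheskidovZengZhang2024, Thm. 1.1] and are not placed in `L¹_t L^∞_x` by their authors, while on `ℝ³` and for one ROUGH compactly supported `L²` datum infinitely many suitable Leray–Hopf solutions in every `L^s_t L^q_x`, `q ≥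 2`, `3/q + 2/s > 1`, are announced (computer-assisted, unrefereed as of 2026-08) [cite: HouWangYang2025, Thm. 1]; from REGULAR data weak–strong uniqueness keeps Leray–Hopf solutions unique while a strong solution exists, so forward regularity criteria for Leray–Hopf solutions in `L^p_t L^∞_x` / `L^{2,∞}_t L^∞_x` (Type-I exclusion; catalogued `LeraySelfSimilarBlowupExclusion`, `AxisymmetricTypeIExclusion`) are untouched by this entry; (c) the constructions say nothing for `p ≥ 2`: the method "heavily relies on the constraint `p < 2` (`q = ∞`) and is not able to achieve the nonuniqueness of weak solutions in `X^{p,q}` for `p ≥ 2` and `q ≥ 2`" [cite: CheskidovLuo2022, §1.6 p. 6] (but see scope (iv) for the part of that region covered by other constructions).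
scope_caveats: (i) periodic setting `𝕋^d = ℝ^d/ℤ^d` with zero-mean solutions, viscosity `1`, no force, as printed [cite: CheskidovLuo2022, §1.1]; nothing is asserted on `ℝ^d` (where finite-energy `C_t L²` non-uniqueness à la Buckmaster–Vicol is meanwhile known by a localized scheme, Miao–Nie–Ye 2024, arXiv:2412.10404, Thm. 1.2, but no `L^p_t L^∞_x` statement was found); (ii) a statement about weak solutions in the sense of Def. 1.1 ("very weak", `L²_{t,x}`, no energy inequality): the competitors are not Leray–Hopf and have unbounded kinetic energy, so the barrier does not touch uniqueness WITHIN `L^∞_t L²_x`, the energy class or the Leray–Hopf class (`Literature.Analysis.FluidPDE.LerayHopfNonUniqueness`; contested only on `ℝ³` from rough data [cite: HouWangYang2025, Thm. 1]) nor the summit's smooth solutions, which are unique while they exist [cite: CheskidovLuo2022, §1.1 and §1.2 (paragraph after Thm. 1.6)]; (iii) the accepted weak-solution predicate tests against divergence-free fields vanishing near `T` whereas Def. 1.1 allows `φ = 0` only for `t ≥ T` — equivalent for `L²_{t,x}` fields but not formalised; in the `∀∃` fact this only weakens the hypothesis; (iv) only `q = ∞` of Conjecture 1.4 is settled HERE (hence,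 on the torus, every `X^{p,q}` with `p < 2`); of the remaining supercritical region `{2/p + d/q > 1, p ≥ 2}` the classes `C_t L^{2+}` / `C_t H^β` in `d = 3` [cite: BuckmasterVicol2019AnnMath, Thm. 1.2] [cite: BuckmasterColomboVicol2021, Thm. 1.1], `C_t L^q` for some `2 < q ≪ 3` in `d = 3` (Miao–Zhao 2025, arXiv:2501.09698, Thm. 1.2) and `H^{1/200-}` in `d ≥ 4` (Luo 2019) are non-unique as well [cite: CheskidovLuo2022, §1.2 p. 4]; open: the rest, in particular `C_t L^q_x` with `q ↑ d` and `L^p_t L^q_x` near the Ladyzhenskaya–Prodi–Serrin line with `2 ≤ p < ∞` [cite: CheskidovLuo2022, §1.6 p. 6]; (v) in `CheskidovLuo2022MainTheorem` the `L¹_t W^{1,q}_x` regularity/closeness is print-only, and "interval of regularity" is rendered by joint smoothness of the given representative on a closed interval; (vi) audit 2026-08-16: the technique-class tokens (`sub-LPS-uniqueness`, `weak-solution-uniqueness-criteria`, `mixed-lebesgue-class-selection`, …) are covered only for criteria whose class CONTAINS the competitors (very weak, zero mean, `L^p_t L^∞_x ∩ L¹_t W^{1,q}_x`, smooth off a closed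 set of times of Hausdorff dimension `≤ ε`, of unbounded kinetic energy) — a route about Leray–Hopf, suitable, finite-energy (`L^∞_t L²`) or classical solutions addresses this entry by saying so (evasion (b)); the fact is moreover PROVED in the tree (`SharpLpLinftyNonuniqueness_holds`, `CheskidovLuo2022MainTheorem_holds`), so only its SCOPE, not its truth, can be contested.
status: established -/
def SharpLpLinftyNonuniqueness : Prop :=
  ∀ (n : ℕ), 2 ≤ n → ∀ (T : ℝ), 0 < T → ∀ (p : ℝ), 1 ≤ p → p < 2 →
    ∀ (u₀ : (𝕋^n) → ℝ^n) (u : ℝ → (𝕋^n) → ℝ^n),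
      MemLp u₀ 2 volume → Literature.Analysis.FunctionSpaces.Torus.IsWeaklyDivFree u₀ → Literature.Analysis.FunctionSpaces.Torus.HasZeroMean u₀ →
      Literature.Analysis.FunctionSpaces.Torus.IsWeakNSSolutionWithDataOn T 1 u₀ u →
      (∀ᵐ t ∂(volume.restrict (Ioo 0 T)), Literature.Analysis.FunctionSpaces.Torus.HasZeroMean (u t)) →
      Literature.Analysis.FluidPDE.Torus.MemLqLp (ENNReal.ofReal p) ∞ u (Ioo 0 T) →
      (∃ a b : ℝ, 0 ≤ a ∧ a < b ∧ b ≤ T ∧ Literature.Analysis.FunctionSpaces.Torus.IsSmoothSpaceTimeOn (Icc a b) u) →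
      ∃ v : ℝ → (𝕋^n) → ℝ^n,
        Literature.Analysis.FunctionSpaces.Torus.IsWeakNSSolutionWithDataOn T 1 u₀ v ∧
        (∀ᵐ t ∂(volume.restrict (Ioo 0 T)), Literature.Analysis.FunctionSpaces.Torus.HasZeroMean (v t)) ∧
        Literature.Analysis.FluidPDE.Torus.MemLqLp (ENNReal.ofReal p) ∞ v (Ioo 0 T) ∧
        (¬ ∀ᵐ t ∂(volume.restrict (Ioo 0 T)), v t =ᵐ[volume] u t) ∧
        ¬ Literature.Analysis.FluidPDE.Torus.IsLerayHopfOn T 1 0 u₀ v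

/-! ### The zero solution: a witness with an interval of regularity -/

variable {n : ℕ}

/-- The zero field is a weak solution with zero datum on `𝕋ⁿ × [0,T)` (all integrands vanish).
[folklore] -/
theorem isWeakNSSolutionWithDataOn_zero (T ν : ℝ) :
    Literature.Analysis.FunctionSpaces.Torus.IsWeakNSSolutionWithDataOn T ν (0 : (𝕋^n) → ℝ^n) (0 : ℝ → (𝕋^n) → ℝ^n) := by
  refine ⟨?_, ?_, ?_, ?_⟩
  · exact aestronglyMeasurable_const (b := (0 : ℝ^n))
  · simp
  · exact Filter.Eventually.of_forall fun t θ _ => by simp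
  · intro ψ _ _
    simp

/-- The zero field lies in every `L^p(S; L^q(𝕋ⁿ))`. [folklore] -/
theorem memLqLp_zero (q r : ℝ≥0∞) (S : Set ℝ) :
    Literature.Analysis.FluidPDE.Torus.MemLqLp q r (0 : ℝ → (𝕋^n) → ℝ^n) S := by
  refine ⟨Filter.Eventually.of_forall fun t => ?_, ?_⟩
  · simp
  · simp [Literature.Analysis.FluidPDE.eLqLpNorm]

/-- The zero field is jointly smooth on every time set. [folklore] -/
theorem isSmoothSpaceTimeOn_zero (S : Set ℝ) :
    Literature.Analysis.FunctionSpaces.Torus.IsSmoothSpaceTimeOn S (0 : ℝ → (𝕋^n) → ℝ^n) := by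
  change ContDiffOn ℝ _ (Literature.Analysis.FunctionSpaces.Torus.stLift (0 : ℝ → (𝕋^n) → ℝ^n)) _
  have : Literature.Analysis.FunctionSpaces.Torus.stLift (0 : ℝ → (𝕋^n) → ℝ^n) = 0 := by
    funext z; rfl
  rw [this]
  exact contDiffOn_const

/-- **Corollary (the footnote to Thm. 1.6 applied to the smooth solution `u ≡ 0`): the rest state
is not the only weak solution in `L^p_t L^∞_x`, `p < 2`, issuing from zero.** For `n ≥ 2`, `T > 0`,
`1 ≤ p < 2` there is a weak solution `v` of the unforced Navier–Stokes equations on `𝕋ⁿ × [0,T)`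
with datum `0`, of zero mean, in `L^p(0,T; L^∞)`, which is not a.e. zero and not Leray–Hopf.
Proved from the barrier fact. [cite: CheskidovLuo2022, Thm. 1.6 (footnote 2)] -/
theorem SharpLpLinftyNonuniqueness.zero_datum_nonunique (h : SharpLpLinftyNonuniqueness)
    (hn : 2 ≤ n) {T : ℝ} (hT : 0 < T) {p : ℝ} (hp₁ : 1 ≤ p) (hp₂ : p < 2) :
    ∃ v : ℝ → (𝕋^n) → ℝ^n,
      Literature.Analysis.FunctionSpaces.Torus.IsWeakNSSolutionWithDataOn T 1 0 v ∧
      (∀ᵐ t ∂(volume.restrict (Ioo 0 T)), Literature.Analysis.FunctionSpaces.Torus.HasZeroMean (v t)) ∧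
      Literature.Analysis.FluidPDE.Torus.MemLqLp (ENNReal.ofReal p) ∞ v (Ioo 0 T) ∧
      (¬ ∀ᵐ t ∂(volume.restrict (Ioo 0 T)), v t =ᵐ[volume] (0 : (𝕋^n) → ℝ^n)) ∧
      ¬ Literature.Analysis.FluidPDE.Torus.IsLerayHopfOn T 1 0 0 v := by
  have h0 := h n hn T hT p hp₁ hp₂ 0 0 (by simp)
    (fun θ _ => by simp) (by simp [Literature.Analysis.FunctionSpaces.Torus.HasZeroMean]) (isWeakNSSolutionWithDataOn_zero T 1)
    (Filter.Eventually.of_forall fun t => by simp [Literature.Analysis.FunctionSpaces.Torus.HasZeroMean]) (memLqLp_zero _ _ _)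
    ⟨0, T, le_rfl, hT, le_rfl, isSmoothSpaceTimeOn_zero _⟩
  simpa using h0

/-- Reformulation as the failure of a uniqueness principle: it is NOT the case that (for some
`n ≥ 2`, `T > 0`, `1 ≤ p < 2`) weak solutions on `𝕋ⁿ × [0,T)` of zero mean in
`L^p(0,T; L^∞)` are determined by their datum. [cite: CheskidovLuo2022, Thm. 1.6] -/
theorem SharpLpLinftyNonuniqueness.not_unique (h : SharpLpLinftyNonuniqueness) (hn : 2 ≤ n)
    {T : ℝ} (hT : 0 < T) {p : ℝ} (hp₁ : 1 ≤ p) (hp₂ : p < 2) :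
    ¬ ∀ (u₀ : (𝕋^n) → ℝ^n) (u v : ℝ → (𝕋^n) → ℝ^n),
        Literature.Analysis.FunctionSpaces.Torus.IsWeakNSSolutionWithDataOn T 1 u₀ u → Literature.Analysis.FunctionSpaces.Torus.IsWeakNSSolutionWithDataOn T 1 u₀ v →
        (∀ᵐ t ∂(volume.restrict (Ioo 0 T)), Literature.Analysis.FunctionSpaces.Torus.HasZeroMean (u t)) →
        (∀ᵐ t ∂(volume.restrict (Ioo 0 T)), Literature.Analysis.FunctionSpaces.Torus.HasZeroMean (v t)) →
        Literature.Analysis.FluidPDE.Torus.MemLqLp (ENNReal.ofReal p) ∞ u (Ioo 0 T) →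
        Literature.Analysis.FluidPDE.Torus.MemLqLp (ENNReal.ofReal p) ∞ v (Ioo 0 T) →
        ∀ᵐ t ∂(volume.restrict (Ioo 0 T)), v t =ᵐ[volume] u t := by
  intro hall
  obtain ⟨v, hv, hmean, hLp, hne, -⟩ := h.zero_datum_nonunique hn hT hp₁ hp₂
  exact hne (hall 0 0 v (isWeakNSSolutionWithDataOn_zero T 1) hv
    (Filter.Eventually.of_forall fun t => by simp [Literature.Analysis.FunctionSpaces.Torus.HasZeroMean]) hmean (memLqLp_zero _ _ _) hLp)

end Literature.Barriers.NavierStokesRegularity
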